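import Summits.CriticalPhenomena.PercolationContinuityZ3.Theorems.PercNearOneGluingNoHeavyLowerTailMergeStability
import Summits.CriticalPhenomena.PercolationContinuityZ3.Theorems.PercNearOneGluingNoHeavyLowerTailChampionStabilityRelay
import Summits.CriticalPhenomena.PercolationContinuityZ3.Theorems.PercNearOneGluingNoHeavyLowerTailCILOwnEdgeStability
import HarnessLib

/-!
# `NoHeavyLowerTail` (stmt-CriticalPhenomena-4575) — the HULL-PORT TRANSFER inequality closes the crux

Support file (prover `prim-lf-2`, lemma factory "deletion–contraction / pivotal edge"; `--supports stmt-CriticalPhenomena-4575`).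
No definitions, no named facts, no sorries.

Notation: `μ_w = prodBernoulli w` on `Fin n`, relays `A`, level `j`, `I_w(y) = μ_w{|π(y)| ≤ j}` (lightness), observer `o ∉ A`,
`L = {1 ≤ N ≤ j}` with `N = |π(o)|`, and for a pair `s(o,v)` of weight `0` the GLUED weights `w₁ = w[s(o,v) ↦ 1]`.

**The hull-port transfer inequality (GT, hypothesis `hGT` below; census name GMCX, memo CANDIDATES.md §A0 of the seat).**
For a NON-relay partner `v` and every relay `x` with no pair to `o` and none to `v`,

  `μ_{w₁}(L) + I_w(x) ≤ I_{w₁}(x) + max_{a ∈ A} I_w(a)`,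

stated with a champion `c` of `w` realising the maximum.  It is hypothesis-free in `x` (no witness rule): the merge damage
`I_w(x) − I_{w₁}(x)` of ANY far relay plus the bad mass of the glued observer is at most the champion's lightness.  (The census
form is sharper — the maximum runs over the hull PORTS of `o, v` only — and has 0 violations in 1.0e5 exact-rational checks and
~10³ adversarial climbs; the weaker all-relay form used here is what the crux needs.)

* `HullPortTransfer.glue_le` — after gluing BOTH `s(o,v)` and a pair `s(c,z)`, `z ∈ {o,v}`, the champion sits in the observer's
  cluster, so `μ(L) ≤ μ(R_c)` (pull back along `insert`, `ChampionStability.real_update_one_eq`; pointwise).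
* `HullPortTransfer.peel` — one-bond decomposition of `μ_{w₁}` at a pair `s(c,z)` (`stub_oneBondDecomp_k15`): the glued side is
  `glue_le`, the deleted side is the same claim for `w[s(c,z) ↦ 0]` (needed only when `w s(c,z) < 1`).
* `mergeStability_of_hullPortTransfer` — **GT ⇒ `stub_mergeStability`** (prim-gen-swap): a relay partner is the tree theorem
  `mergeStability_of_mem`; for a non-relay partner peel the champion's pairs to `o` and to `v` (it stays champion:
  `CutObserver.champion_of_erase_own_edge`, prover prim-gen-induct) and apply GT with `x := c`.
* `noHeavyLowerTail_of_hullPortTransfer` — **GT ⇒ NoHeavyLowerTail**, through `noHeavyLowerTail_of_mergeStability`.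
-/

noncomputable section

namespace Summit.CriticalPhenomena.PercolationContinuityZ3.Theorems

open MeasureTheory Set Literature.Probability.LatticeModels Literature.Probability.Percolation
open scoped Classical BigOperators

variable {n : ℕ}

namespace HullPortTransfer

/-- If `c ↔ o` in `ω`, the relay sets seen from `o` and from `c` coincide. [folklore] -/
theorem filter_eq_of_reachable (A : Finset (Fin n)) {ω : BondConfig (Fin n)} {o c : Fin n}
    (h : (openGraph ω).Reachable c o) :
    (A.filter fun x => ω ∈ openConn o x) = (A.filter fun x => ω ∈ openConn c x) := by
  apply Finset.filter_congr
  intro x _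
  change (openGraph ω).Reachable o x ↔ (openGraph ω).Reachable c x
  exact ⟨fun hox => h.trans hox, fun hcx => h.symm.trans hcx⟩

/-- **Both pairs glued.**  With `s(o,v)` and `s(c,z)` (`z = o` or `z = v`) raised to `1` from `0`, the champion `c` lies in the
observer's cluster almost surely, so `μ(1 ≤ N ≤ j) ≤ μ(|π(c)| ≤ j)`.  Pull-back along `insert` twice; pointwise. [folklore] -/
theorem glue_le (u : Sym2 (Fin n) → unitInterval) (A : Finset (Fin n)) (o v c z : Fin n) (j : ℕ)
    (hov : o ≠ v) (hz : z = o ∨ z = v) (hcz : c ≠ z)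
    (huov : u s(o, v) = 0) (huf : u s(c, z) = 0) (hne : s(o, v) ≠ s(c, z)) :
    (prodBernoulli (Function.update (Function.update u s(c, z) 1) s(o, v) 1)).real
        {ω : BondConfig (Fin n) |
          1 ≤ (A.filter fun x => ω ∈ openConn o x).card ∧ (A.filter fun x => ω ∈ openConn o x).card ≤ j} ≤
      (prodBernoulli (Function.update (Function.update u s(c, z) 1) s(o, v) 1)).real
        {ω : BondConfig (Fin n) | (A.filter fun x => ω ∈ openConn c x).card ≤ j} := by
  have h1 : (Function.update u s(c, z) 1) s(o, v) = 0 := by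
    rw [Function.update_of_ne hne]; exact huov
  rw [ChampionStability.real_update_one_eq _ h1, ChampionStability.real_update_one_eq _ h1,
    ChampionStability.real_update_one_eq _ huf, ChampionStability.real_update_one_eq _ huf]
  refine measureReal_mono ?_ (measure_ne_top _ _)
  intro ω hω
  simp only [Set.mem_preimage, Set.mem_setOf_eq] at hω ⊢
  set ω' : BondConfig (Fin n) := insert s(o, v) (insert s(c, z) ω) with hω'
  have hov_mem : s(o, v) ∈ ω' := Set.mem_insert _ _
  have hcz_mem : s(c, z) ∈ ω' := Set.mem_insert_of_mem _ (Set.mem_insert _ _)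
  have hadj_cz : (openGraph ω').Adj c z := (openGraph_adj ω' c z).2 ⟨hcz_mem, hcz⟩
  have hadj_ov : (openGraph ω').Adj o v := (openGraph_adj ω' o v).2 ⟨hov_mem, hov⟩
  have hreach : (openGraph ω').Reachable c o := by
    rcases hz with hzo | hzv
    · rw [hzo] at hadj_cz
      exact hadj_cz.reachable
    · rw [hzv] at hadj_cz
      exact hadj_cz.reachable.trans hadj_ov.reachable.symm
  rw [← filter_eq_of_reachable A hreach]
  exact hω.2

/-- **Peeling one pair at the champion.**  One-bond decomposition of `μ_{w[s(o,v)↦1]}` at `s(c,z)`, `z ∈ {o,v}`: the glued side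
is `glue_le`; the deleted side is the claim for `w[s(c,z) ↦ 0]`, required only when `w s(c,z) < 1`. [folklore] -/
theorem peel (w : Sym2 (Fin n) → unitInterval) (A : Finset (Fin n)) (o v c z : Fin n) (j : ℕ)
    (hov : o ≠ v) (hz : z = o ∨ z = v) (hcz : c ≠ z)
    (hwov : w s(o, v) = 0) (hne : s(o, v) ≠ s(c, z))
    (hrec : (w s(c, z) : ℝ) < 1 →
      (prodBernoulli (Function.update (Function.update w s(c, z) 0) s(o, v) 1)).real
          {ω : BondConfig (Fin n) |
            1 ≤ (A.filter fun x => ω ∈ openConn o x).card ∧ (A.filter fun x => ω ∈ openConn o x).card ≤ j} ≤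
        (prodBernoulli (Function.update (Function.update w s(c, z) 0) s(o, v) 1)).real
          {ω : BondConfig (Fin n) | (A.filter fun x => ω ∈ openConn c x).card ≤ j}) :
    (prodBernoulli (Function.update w s(o, v) 1)).real
        {ω : BondConfig (Fin n) |
          1 ≤ (A.filter fun x => ω ∈ openConn o x).card ∧ (A.filter fun x => ω ∈ openConn o x).card ≤ j} ≤
      (prodBernoulli (Function.update w s(o, v) 1)).real
        {ω : BondConfig (Fin n) | (A.filter fun x => ω ∈ openConn c x).card ≤ j} := by
  set W : Sym2 (Fin n) → unitInterval := Function.update w s(o, v) 1 with hW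
  set f : Sym2 (Fin n) := s(c, z) with hf
  set SL : Set (BondConfig (Fin n)) := {ω |
      1 ≤ (A.filter fun x => ω ∈ openConn o x).card ∧ (A.filter fun x => ω ∈ openConn o x).card ≤ j} with hSL
  set SR : Set (BondConfig (Fin n)) := {ω | (A.filter fun x => ω ∈ openConn c x).card ≤ j} with hSR
  have hWf : W f = w f := by rw [hW, Function.update_of_ne (Ne.symm hne)]
  have hW0 : Function.update W f 0 = Function.update (Function.update w f 0) s(o, v) 1 := by
    rw [hW, Function.update_comm (Ne.symm hne)]
  have hW1 : Function.update W f 1 = Function.update (Function.update (Function.update w f 0) f 1) s(o, v) 1 := by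
    rw [hW, Function.update_idem, Function.update_comm hne]
  have hglue : (prodBernoulli (Function.update W f 1)).real SL ≤ (prodBernoulli (Function.update W f 1)).real SR := by
    rw [hW1]
    have huov : (Function.update w f 0) s(o, v) = 0 := by
      rw [Function.update_of_ne hne]; exact hwov
    have huf : (Function.update w f 0) f = 0 := Function.update_self _ _ _
    exact glue_le (Function.update w f 0) A o v c z j hov hz hcz huov huf hne
  rw [stub_oneBondDecomp_k15 n W f SL, stub_oneBondDecomp_k15 n W f SR, hWf, hW0]
  have hp0 : 0 ≤ (w f : ℝ) := (w f).2.1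
  have hp1 : (w f : ℝ) ≤ 1 := (w f).2.2
  have hb : (w f : ℝ) * (prodBernoulli (Function.update W f 1)).real SL ≤
      (w f : ℝ) * (prodBernoulli (Function.update W f 1)).real SR :=
    mul_le_mul_of_nonneg_left hglue hp0
  by_cases ht : (w f : ℝ) < 1
  · have ha : (1 - (w f : ℝ)) * (prodBernoulli (Function.update (Function.update w f 0) s(o, v) 1)).real SL ≤
        (1 - (w f : ℝ)) * (prodBernoulli (Function.update (Function.update w f 0) s(o, v) 1)).real SR :=
      mul_le_mul_of_nonneg_left (hrec ht) (by linarith)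
    exact add_le_add ha hb
  · have h1 : (w f : ℝ) = 1 := le_antisymm hp1 (not_lt.1 ht)
    rw [h1]
    simp only [sub_self, zero_mul, zero_add]
    rw [h1] at hb
    exact hb

end HullPortTransfer

open HullPortTransfer CutObserver in
/-- **The hull-port transfer inequality implies merge stability** (`stub_mergeStability`, prim-gen-swap) for every champion
and every partner: a relay partner is `mergeStability_of_mem`; for a non-relay partner `v`, peel the champion's pairs to `o` and
to `v` (`peel`, the champion surviving by `champion_of_erase_own_edge`) and apply the transfer inequality with `x := c`. -/
theorem mergeStability_of_hullPortTransfer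
    (hGT : ∀ (n : ℕ) (w : Sym2 (Fin n) → unitInterval) (A : Finset (Fin n)) (o v x c : Fin n) (j : ℕ),
      o ∉ A → v ∉ A → v ≠ o → x ∈ A → c ∈ A → w s(o, v) = 0 → w s(x, o) = 0 → w s(x, v) = 0 →
      (∀ a ∈ A,
        (Literature.Probability.LatticeModels.prodBernoulli w).real
            {ω : Literature.Probability.Percolation.BondConfig (Fin n) |
              (A.filter fun y => ω ∈ Literature.Probability.Percolation.openConn a y).card ≤ j} ≤
          (Literature.Probability.LatticeModels.prodBernoulli w).real
            {ω : Literature.Probability.Percolation.BondConfig (Fin n) |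
              (A.filter fun y => ω ∈ Literature.Probability.Percolation.openConn c y).card ≤ j}) →
      (Literature.Probability.LatticeModels.prodBernoulli (Function.update w s(o, v) 1)).real
          {ω : Literature.Probability.Percolation.BondConfig (Fin n) |
            1 ≤ (A.filter fun y => ω ∈ Literature.Probability.Percolation.openConn o y).card ∧
              (A.filter fun y => ω ∈ Literature.Probability.Percolation.openConn o y).card ≤ j} +
        (Literature.Probability.LatticeModels.prodBernoulli w).real
          {ω : Literature.Probability.Percolation.BondConfig (Fin n) |
            (A.filter fun y => ω ∈ Literature.Probability.Percolation.openConn x y).card ≤ j} ≤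
      (Literature.Probability.LatticeModels.prodBernoulli (Function.update w s(o, v) 1)).real
          {ω : Literature.Probability.Percolation.BondConfig (Fin n) |
            (A.filter fun y => ω ∈ Literature.Probability.Percolation.openConn x y).card ≤ j} +
        (Literature.Probability.LatticeModels.prodBernoulli w).real
          {ω : Literature.Probability.Percolation.BondConfig (Fin n) |
            (A.filter fun y => ω ∈ Literature.Probability.Percolation.openConn c y).card ≤ j}) :
    ∀ (n : ℕ) (w : Sym2 (Fin n) → unitInterval) (A : Finset (Fin n)) (o v aStar : Fin n) (j : ℕ),
      o ∉ A → v ≠ o → aStar ∈ A → w s(o, v) = 0 →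
      (∀ a ∈ A,
        (Literature.Probability.LatticeModels.prodBernoulli w).real
            {ω : Literature.Probability.Percolation.BondConfig (Fin n) |
              (A.filter fun x => ω ∈ Literature.Probability.Percolation.openConn a x).card ≤ j} ≤
          (Literature.Probability.LatticeModels.prodBernoulli w).real
            {ω : Literature.Probability.Percolation.BondConfig (Fin n) |
              (A.filter fun x => ω ∈ Literature.Probability.Percolation.openConn aStar x).card ≤ j}) →
      (Literature.Probability.LatticeModels.prodBernoulli (Function.update w s(o, v) 1)).real
          {ω : Literature.Probability.Percolation.BondConfig (Fin n) |
            1 ≤ (A.filter fun x => ω ∈ Literature.Probability.Percolation.openConn o x).card ∧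
              (A.filter fun x => ω ∈ Literature.Probability.Percolation.openConn o x).card ≤ j} ≤
        (Literature.Probability.LatticeModels.prodBernoulli (Function.update w s(o, v) 1)).real
          {ω : Literature.Probability.Percolation.BondConfig (Fin n) |
            (A.filter fun x => ω ∈ Literature.Probability.Percolation.openConn aStar x).card ≤ j} := by
  intro n w A o v aStar j ho hvo haA hw0 hchamp
  by_cases hvA : v ∈ A
  · exact mergeStability_of_mem n w A o v aStar j ho hvo hvA haA hw0 hchamp
  have hao : aStar ≠ o := fun h => ho (h ▸ haA)
  have hav : aStar ≠ v := fun h => hvA (h ▸ haA)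
  have hov : o ≠ v := fun h => hvo h.symm
  have hne1 : s(o, v) ≠ s(aStar, o) := by
    intro h
    rcases Sym2.eq_iff.1 h with ⟨h1, -⟩ | ⟨-, h2⟩
    · exact hao h1.symm
    · exact hav (h2 ▸ rfl) |>.elim
  have hne2 : s(o, v) ≠ s(aStar, v) := by
    intro h
    rcases Sym2.eq_iff.1 h with ⟨h1, -⟩ | ⟨-, h2⟩
    · exact hao h1.symm
    · exact hav h2.symm
  -- peel the pair `s(aStar, o)`
  refine peel w A o v aStar o j hov (Or.inl rfl) hao hw0 hne1 ?_
  intro ht1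
  set w' : Sym2 (Fin n) → unitInterval := Function.update w s(aStar, o) 0 with hw'
  have hchamp' : ∀ a ∈ A,
      (prodBernoulli w').real {ω : BondConfig (Fin n) | (A.filter fun x => ω ∈ openConn a x).card ≤ j} ≤
        (prodBernoulli w').real {ω : BondConfig (Fin n) | (A.filter fun x => ω ∈ openConn aStar x).card ≤ j} :=
    champion_of_erase_own_edge w A aStar o j hao ht1 hchamp
  have hw'ov : w' s(o, v) = 0 := by
    rw [hw', Function.update_of_ne hne1]; exact hw0
  -- peel the pair `s(aStar, v)`
  refine peel w' A o v aStar v j hov (Or.inr rfl) hav hw'ov hne2 ?_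
  intro ht2
  set w'' : Sym2 (Fin n) → unitInterval := Function.update w' s(aStar, v) 0 with hw''
  have hchamp'' : ∀ a ∈ A,
      (prodBernoulli w'').real {ω : BondConfig (Fin n) | (A.filter fun x => ω ∈ openConn a x).card ≤ j} ≤
        (prodBernoulli w'').real {ω : BondConfig (Fin n) | (A.filter fun x => ω ∈ openConn aStar x).card ≤ j} :=
    champion_of_erase_own_edge w' A aStar v j hav ht2 hchamp'
  have hw''ov : w'' s(o, v) = 0 := by
    rw [hw'', Function.update_of_ne hne2]; exact hw'ov
  have hne3 : s(aStar, o) ≠ s(aStar, v) := by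
    intro h
    rcases Sym2.eq_iff.1 h with ⟨-, h2⟩ | ⟨h1, -⟩
    · exact hov h2
    · exact hav h1
  have hw''ao : w'' s(aStar, o) = 0 := by
    rw [hw'', Function.update_of_ne hne3, hw']; exact Function.update_self _ _ _
  have hw''av : w'' s(aStar, v) = 0 := by rw [hw'']; exact Function.update_self _ _ _
  have key := hGT n w'' A o v aStar aStar j ho hvA hvo haA haA hw''ov hw''ao hw''av hchamp''
  linarith

/-- **The hull-port transfer inequality closes the crux**: GT ⇒ `stub_mergeStability` ⇒ CIL_j (all `|A|`, `j`) ⇒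
`NoHeavyLowerTail`, the last two steps being the landed `noHeavyLowerTail_of_mergeStability` (prim-gen-swap). -/
theorem noHeavyLowerTail_of_hullPortTransfer
    (hGT : ∀ (n : ℕ) (w : Sym2 (Fin n) → unitInterval) (A : Finset (Fin n)) (o v x c : Fin n) (j : ℕ),
      o ∉ A → v ∉ A → v ≠ o → x ∈ A → c ∈ A → w s(o, v) = 0 → w s(x, o) = 0 → w s(x, v) = 0 →
      (∀ a ∈ A,
        (Literature.Probability.LatticeModels.prodBernoulli w).real
            {ω : Literature.Probability.Percolation.BondConfig (Fin n) |
              (A.filter fun y => ω ∈ Literature.Probability.Percolation.openConn a y).card ≤ j} ≤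
          (Literature.Probability.LatticeModels.prodBernoulli w).real
            {ω : Literature.Probability.Percolation.BondConfig (Fin n) |
              (A.filter fun y => ω ∈ Literature.Probability.Percolation.openConn c y).card ≤ j}) →
      (Literature.Probability.LatticeModels.prodBernoulli (Function.update w s(o, v) 1)).real
          {ω : Literature.Probability.Percolation.BondConfig (Fin n) |
            1 ≤ (A.filter fun y => ω ∈ Literature.Probability.Percolation.openConn o y).card ∧
              (A.filter fun y => ω ∈ Literature.Probability.Percolation.openConn o y).card ≤ j} +
        (Literature.Probability.LatticeModels.prodBernoulli w).real
          {ω : Literature.Probability.Percolation.BondConfig (Fin n) |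
            (A.filter fun y => ω ∈ Literature.Probability.Percolation.openConn x y).card ≤ j} ≤
      (Literature.Probability.LatticeModels.prodBernoulli (Function.update w s(o, v) 1)).real
          {ω : Literature.Probability.Percolation.BondConfig (Fin n) |
            (A.filter fun y => ω ∈ Literature.Probability.Percolation.openConn x y).card ≤ j} +
        (Literature.Probability.LatticeModels.prodBernoulli w).real
          {ω : Literature.Probability.Percolation.BondConfig (Fin n) |
            (A.filter fun y => ω ∈ Literature.Probability.Percolation.openConn c y).card ≤ j}) :
    Summit.CriticalPhenomena.PercolationContinuityZ3.Theses.PercNearOneGluing.NoHeavyLowerTail :=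
  noHeavyLowerTail_of_mergeStability (mergeStability_of_hullPortTransfer hGT)

end Summit.CriticalPhenomena.PercolationContinuityZ3.Theorems

end
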